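import Mathlib

/-!
# TiltedLandingLaw421R3 — C6 (rh-idea-4 g48) «OneMateWinding»: the single-mate winding window in closed form

Mathlib-only kernel of C2 g60 RESULT-1 §(3) (board (CA1198); token-169 candidate).  FRAME: top `T = i` (Jensen circle `|z| = 1`, closed
base `[-1, 1]`), ONE crossing mate `m = u + iv`, `u = -(1+δ)`, covering the left foot `-1` (`0 ≤ δ < v`), `P = (z²+1)((z-u)²+v²)`,
`F = e^{gz}·P`, `Φ = F′/F = g + P′/P`, `P′/P = S u v` (the four-pole sum, §1).
* §1 CIRCLE IDENTITIES: on `|z - u| = v` the conjugate pole pair sums to the REAL `1/(Re z - u)` (`pair_sum_on_circle`; `u = 0, v = 1`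
  is the lone-pair identity of `T`); so at `z₁ = x₁ + i·y₁ := ∂D_T ∩ ∂D_m` the value `S u v z₁ = 1/x₁ + 1/(x₁-u)` is REAL (`S_nodal`) —
  a nodal point of `Im Φ` on T's left arc for EVERY tilt `g` (`im_tilt_add_S_nodal`): the g-independent «arc event», event tilt
  `g₁ := -(1/x₁ + 1/(x₁-u))`; foot tilt `g_F := -S u v (-1) = 1 - 2δ/(δ²+v²)` (`S_foot_eq_neg_gF`).
* §2 CLOSED FORMS: `x₁ = -(1 - A/c)`; ★`K_eq`: `K := g₁ - g_F = A·(1/(c-A) - 2/(D₀(2δ+D₀)))`, `A = v²-δ²`, `c = 2(1+δ)`, `D₀ = δ²+v²`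
  (`c - A = |i-u|² - v²` = power of `T` w.r.t. the mate circle, `> 0` iff `T ∉ D̄_m`).
* §3 SIGN LAW: ★★`K_neg`: `0 ≤ δ < v ≤ 1 ⇒ K < 0` (via `sign_poly`: `(5+6δ+5δ²) - (2+δ+δ²)² = (1-δ²)(1+δ)²`); `K_pos_iff`: for
  `T ∉ D̄_m`, `0 < K ⟺ 5+6δ+5δ² < (δ²+v²+1+δ)²` — a TALLER toucher opens the window: `K (1/2) (3/2) = 54/35` (`K_tall`).
READING (C2 g60 (1)–(3), pen-and-paper, NOT kernel): argument principle on T's indented circle, `Z - Π = n_R + n_L + 1`, and in this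
frame `n_L(g) = -1 ⟺ g_F < g < g₁`; `K < 0` = no clockwise window = the top is pinned for EVERY tilt against one not-taller mate; the tree
hypothesis `RhW08.Lens1Pinning.NoTallerToucher` (⇒ `v ≤ Im T`) is what closes it.  C6 exact check `pub/ideators/rh-idea-4/w7c8/c11/g48/onemate/`:
closed forms exact on 1 213 rational rows; at `(δ,v,g) = (1/2,3/2,1)` the quartic `gP + P′` is zero-free on the CLOSED unit disc (exact
Routh–Hurwitz): an unpinned top under a taller toucher.  Nothing here bears on the truth of RH; RH is not proved; ⟨27010⟩/⟨33347⟩ OPEN.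
-/

namespace RhW08.OneMateWinding
open Complex

/-! ## §1 Circle identities: a conjugate pole pair is real on its own Jensen circle -/

/-- On the circle `|z - u| = v`, off the line `Re z = u`, the pole pair `u ± iv` sums to the real number `1/(Re z - u)`. -/
theorem pair_sum_on_circle {z : ℂ} {u v : ℝ} (hz : (z.re - u) ^ 2 + z.im ^ 2 = v ^ 2) (hre : z.re ≠ u) :
    1 / (z - (u + v * I)) + 1 / (z - (u - v * I)) = ((z.re : ℂ) - u)⁻¹ := by
  have ha : z - (u + v * I) ≠ 0 := fun h => hre (sub_eq_zero.mp (by simpa using congrArg Complex.re h))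
  have hb : z - (u - v * I) ≠ 0 := fun h => hre (sub_eq_zero.mp (by simpa using congrArg Complex.re h))
  have hzu : z - u ≠ 0 := fun h => hre (sub_eq_zero.mp (by simpa using congrArg Complex.re h))
  have hxu : ((z.re : ℂ) - u) ≠ 0 := by rw [sub_ne_zero]; exact_mod_cast hre
  have key : (z - (u + v * I)) * (z - (u - v * I)) = 2 * ((z.re : ℂ) - u) * (z - u) := by
    apply Complex.ext <;> simp <;> nlinarith [hz]
  rw [div_add_div _ _ ha hb, key]
  field_simp
  ring

/-- The LONE-PAIR identity of the top `T = i`: on `|z| = 1`, `1/(z-i) + 1/(z+i) = 1/Re z`. -/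
theorem top_pair_sum_on_circle {z : ℂ} (hz : z.re ^ 2 + z.im ^ 2 = 1) (hre : z.re ≠ 0) :
    1 / (z - I) + 1 / (z + I) = ((z.re : ℂ))⁻¹ := by
  simpa using @pair_sum_on_circle z 0 1 (by simpa using hz) hre

/-- `P′/P` of the one-mate frame `P = (z²+1)((z-u)²+v²)`: the four-pole sum. -/
noncomputable def S (u v : ℝ) (z : ℂ) : ℂ := 1 / (z - I) + 1 / (z + I) + (1 / (z - (u + v * I)) + 1 / (z - (u - v * I)))

/-- ★ NODAL POINT: on T's circle AND the mate circle (off the two vertical lines) `P′/P` is REAL, `= 1/Re z + 1/(Re z - u)`. -/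
theorem S_nodal {u v : ℝ} {z : ℂ} (h1 : z.re ^ 2 + z.im ^ 2 = 1) (h2 : (z.re - u) ^ 2 + z.im ^ 2 = v ^ 2) (h0 : z.re ≠ 0)
    (hu : z.re ≠ u) : S u v z = ((z.re : ℂ))⁻¹ + ((z.re : ℂ) - u)⁻¹ := by
  unfold S; rw [top_pair_sum_on_circle h1 h0, pair_sum_on_circle h2 hu]

/-- … so `Im Φ = Im (g + P′/P)` vanishes there for EVERY real tilt `g`: the arc event is g-independent. -/
theorem im_tilt_add_S_nodal {u v : ℝ} (g : ℝ) {z : ℂ} (h1 : z.re ^ 2 + z.im ^ 2 = 1) (h2 : (z.re - u) ^ 2 + z.im ^ 2 = v ^ 2)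
    (h0 : z.re ≠ 0) (hu : z.re ≠ u) : ((g : ℂ) + S u v z).im = 0 := by
  rw [S_nodal h1 h2 h0 hu]; simp

/-! ## §2 The frame in the parameters `(δ, v)`, `u = -(1+δ)`: closed forms -/

/-- Abscissa of the nodal point `∂D_T ∩ ∂D_m`: `x₁ = (1 + u² - v²)/(2u) = -(1 - A/c)`. -/
noncomputable def x₁ (δ v : ℝ) : ℝ := -(1 - (v ^ 2 - δ ^ 2) / (2 * (1 + δ)))

/-- Event tilt at the nodal point: `g₁ = -Re (P′/P)(z₁) = -(1/x₁ + 1/(x₁ - u))`. -/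
noncomputable def g₁ (δ v : ℝ) : ℝ := -((x₁ δ v)⁻¹ + (x₁ δ v + (1 + δ))⁻¹)
/-- Foot tilt: `g_F = -(P′/P)(-1) = 1 - 2δ/(δ²+v²)`. -/
noncomputable def gF (δ v : ℝ) : ℝ := 1 - 2 * δ / (δ ^ 2 + v ^ 2)
/-- Clockwise-window width `K = g₁ - g_F` (C2 g60: `n_L(g) = -1 ⟺ g_F < g < g₁`). -/
noncomputable def K (δ v : ℝ) : ℝ := g₁ δ v - gF δ v

/-- `(x₁, y₁)` with `y₁² = 1 - x₁²` lies on the mate circle too: `(x₁ - u)² + y₁² = v²`. -/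
theorem x₁_on_mate_circle {δ : ℝ} (v : ℝ) (hδ : 0 ≤ δ) : (x₁ δ v + (1 + δ)) ^ 2 + (1 - x₁ δ v ^ 2) = v ^ 2 := by
  have hc : 2 * (1 + δ) ≠ 0 := by positivity
  unfold x₁; field_simp; ring

/-- The nodal point is on the OPEN left arc, `-1 < x₁ < 0`, when the mate covers the foot and `T ∉ D̄_m` (`v² < 1 + (1+δ)²`). -/
theorem x₁_mem {δ v : ℝ} (hδ : 0 ≤ δ) (hδv : δ < v) (hT : v ^ 2 < 1 + (1 + δ) ^ 2) : -1 < x₁ δ v ∧ x₁ δ v < 0 := by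
  have hc : 0 < 2 * (1 + δ) := by positivity
  have h1 : 0 < (v ^ 2 - δ ^ 2) / (2 * (1 + δ)) := div_pos (by nlinarith) hc
  have h2 : (v ^ 2 - δ ^ 2) / (2 * (1 + δ)) < 1 := by rw [div_lt_one hc]; nlinarith
  unfold x₁; constructor <;> linarith

/-- DICTIONARY: `-g₁` is the (real) value of `P′/P` at the nodal point … -/
theorem S_nodal_eq_neg_g₁ {δ v : ℝ} {z : ℂ} (hz : z.re = x₁ δ v) (h1 : z.re ^ 2 + z.im ^ 2 = 1)
    (h2 : (z.re - -(1 + δ)) ^ 2 + z.im ^ 2 = v ^ 2) (h0 : z.re ≠ 0) (hu : z.re ≠ -(1 + δ)) :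
    S (-(1 + δ)) v z = ((-g₁ δ v : ℝ) : ℂ) := by
  rw [S_nodal h1 h2 h0 hu, g₁, neg_neg, hz]; push_cast; simp only [sub_neg_eq_add]

/-- … and `-g_F` its value at the foot `-1`. -/
theorem S_foot_eq_neg_gF {δ v : ℝ} (h : δ ^ 2 + v ^ 2 ≠ 0) : S (-(1 + δ)) v (-1) = ((-gF δ v : ℝ) : ℂ) := by
  have h' : δ * δ + v * v ≠ 0 := by simpa only [sq] using h
  apply Complex.ext
  · rw [Complex.ofReal_re]; simp [S, Complex.normSq_apply]; unfold gF; field_simp; ring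
  · rw [Complex.ofReal_im]; simp [S, Complex.normSq_apply]; field_simp; ring

/-- ★ CLOSED FORM (C2 g60 (3)): `K = A·(1/(c-A) - 2/(D₀(2δ+D₀)))`, `A = v²-δ²`, `c = 2(1+δ)`, `D₀ = δ²+v²`. -/
theorem K_eq {δ v : ℝ} (hδ : 0 ≤ δ) (hδv : δ < v) (hT : v ^ 2 < 1 + (1 + δ) ^ 2) :
    K δ v = (v ^ 2 - δ ^ 2) * (1 / (2 * (1 + δ) - (v ^ 2 - δ ^ 2)) - 2 / ((δ ^ 2 + v ^ 2) * (2 * δ + (δ ^ 2 + v ^ 2)))) := by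
  have hv : 0 < v := lt_of_le_of_lt hδ hδv
  have hc : (2 : ℝ) * (1 + δ) ≠ 0 := by positivity
  have hcA : 2 * (1 + δ) - (v ^ 2 - δ ^ 2) ≠ 0 := by nlinarith
  have hcA' : v ^ 2 - δ ^ 2 - 2 * (1 + δ) ≠ 0 := by nlinarith
  have hD : δ ^ 2 + v ^ 2 ≠ 0 := by positivity
  have hD2 : 2 * δ + (δ ^ 2 + v ^ 2) ≠ 0 := by positivity
  have hx : x₁ δ v = (v ^ 2 - δ ^ 2 - 2 * (1 + δ)) / (2 * (1 + δ)) := by unfold x₁; field_simp; ring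
  have hxu : x₁ δ v + (1 + δ) = (2 * δ + (δ ^ 2 + v ^ 2)) / (2 * (1 + δ)) := by rw [hx]; field_simp; ring
  unfold K g₁ gF; rw [hxu, hx]
  field_simp
  ring

/-! ## §3 The sign law -/

/-- The polynomial identity behind the sign law. -/
theorem sign_poly (δ : ℝ) : (5 + 6 * δ + 5 * δ ^ 2) - (2 + δ + δ ^ 2) ^ 2 = (1 - δ ^ 2) * (1 + δ) ^ 2 := by ring

/-- ★★ SIGN LAW (C2 g60 (3)): against ONE not-taller mate covering the foot (`0 ≤ δ < v ≤ 1 = Im T`) the clockwise window is EMPTY. -/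
theorem K_neg {δ v : ℝ} (hδ : 0 ≤ δ) (hδv : δ < v) (hv : v ≤ 1) : K δ v < 0 := by
  have hv0 : 0 < v := lt_of_le_of_lt hδ hδv
  have hT : v ^ 2 < 1 + (1 + δ) ^ 2 := by nlinarith
  have hA : 0 < v ^ 2 - δ ^ 2 := by nlinarith
  have hcA : 0 < 2 * (1 + δ) - (v ^ 2 - δ ^ 2) := by nlinarith
  have hD : 0 < (δ ^ 2 + v ^ 2) * (2 * δ + (δ ^ 2 + v ^ 2)) := by positivity
  have hv2 : v ^ 2 ≤ 1 := by nlinarith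
  have hδ1 : 0 < 1 - δ := by linarith [lt_of_lt_of_le hδv hv]
  -- bracket < 0 ⟺ D₀(2δ+D₀) < 2(c-A) ⟺ D₀² + 2(1+δ)D₀ < 4(1+δ+δ²); true since D₀ ≤ 1+δ² and `sign_poly`
  have hcore : (δ ^ 2 + v ^ 2) * (2 * δ + (δ ^ 2 + v ^ 2)) < 2 * (2 * (1 + δ) - (v ^ 2 - δ ^ 2)) := by
    nlinarith [sign_poly δ, mul_pos hδ1 (mul_pos (add_pos_of_pos_of_nonneg one_pos hδ) (add_pos_of_pos_of_nonneg one_pos hδ)),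
      mul_nonneg hδ (sub_nonneg.mpr hv2), mul_nonneg (mul_nonneg hδ hδ) (sub_nonneg.mpr hv2), sub_nonneg.mpr hv2]
  rw [K_eq hδ hδv hT, div_sub_div _ _ (ne_of_gt hcA) (ne_of_gt hD)]
  exact mul_neg_of_pos_of_neg hA (div_neg_of_neg_of_pos (by nlinarith) (mul_pos hcA hD))

/-- For `T ∉ D̄_m` the window OPENS iff `5 + 6δ + 5δ² < (δ² + v² + 1 + δ)²` (C2: `v > v*(δ)`, `v*(1/2) ≈ 1.136 > 1`). -/
theorem K_pos_iff {δ v : ℝ} (hδ : 0 ≤ δ) (hδv : δ < v) (hT : v ^ 2 < 1 + (1 + δ) ^ 2) :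
    0 < K δ v ↔ 5 + 6 * δ + 5 * δ ^ 2 < (δ ^ 2 + v ^ 2 + 1 + δ) ^ 2 := by
  have hv0 : 0 < v := lt_of_le_of_lt hδ hδv
  have hA : 0 < v ^ 2 - δ ^ 2 := by nlinarith
  have hcA : 0 < 2 * (1 + δ) - (v ^ 2 - δ ^ 2) := by nlinarith
  have hD : 0 < (δ ^ 2 + v ^ 2) * (2 * δ + (δ ^ 2 + v ^ 2)) := by positivity
  rw [K_eq hδ hδv hT, mul_pos_iff_of_pos_left hA, div_sub_div _ _ (ne_of_gt hcA) (ne_of_gt hD), div_pos_iff_of_pos_right (mul_pos hcA hD)]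
  constructor <;> intro h <;> nlinarith

/-- A TALLER toucher (`δ = 1/2`, `v = 3/2 > 1 = Im T`) OPENS the window, `K = 54/35 > 0`: `NoTallerToucher` is load-bearing;
C2's not-taller near-tangent probe `(δ, v) = (4/5, 41/50)` keeps it closed. -/
theorem K_tall : K (1 / 2) (3 / 2) = 54 / 35 := by norm_num [K, g₁, gF, x₁]

example : 0 < K (1 / 2) (3 / 2) ∧ K (4 / 5) (41 / 50) < 0 :=
  ⟨by rw [K_tall]; norm_num, K_neg (by norm_num) (by norm_num) (by norm_num)⟩

end RhW08.OneMateWinding
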